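import Mathlib.Analysis.Normed.Field.Basic
import Mathlib.Analysis.Normed.Group.Basic
import Mathlib.Analysis.Normed.Group.Continuity
import Mathlib.Topology.MetricSpace.Basic
import Mathlib.Order.Filter.Basic
import Mathlib.Analysis.SpecificLimits.Basic
import Mathlib.Analysis.Complex.Exponential
import Mathlib.Analysis.SpecialFunctions.Pow.Real
import Mathlib.Analysis.SpecialFunctions.Gaussian.FourierTransform
import HarnessLib

/-!
# Dimock, *Ultraviolet stability for QED in d = 3*, §4.3 PROOF OF THEOREM 2 — the STABILITY BOUND (42) ∕ (525)
# «`½ ≤ |Z(N,e)∕Z(N,0)| ≤ 3∕2`» ASSEMBLED from LEMMA 25 (498) and LEMMA 27 (518) via (524)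
# «`Z(N,e)∕Z(N,0) = Z_L(N,e)∕Z(N,0) + Z_S(N,e)∕Z(N,0) = 1 + O(e_K^{1∕4−8ε})`», together with the structure of LEMMA 27's
# proof (519) «It suffices to show that each factor is sufficiently close to one» and «`Z(N,e)∕Z(N,0) → 1` as `e → 0`»
# — the final arithmetic of the paper, PROVED for abstract (complex) quantities with the bounds of the two lemmas

statement-level skeleton of published theorems with citation tags; proofs where landed; nothing here is a claim about the Yang–Mills mass gap

**Citation header (reproduction of PUBLISHED work).** J. Dimock, *Ultraviolet stability for QED in d = 3*, Ann. Henri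
Poincaré **23** (2022) 2113–2205 (= arXiv:2009.01156v2) [Dimock2022UVStabilityQED3], §2.2 THEOREM 2 (42) p.8 L65–76,
§4.2.3 LEMMA 25 (498) p.68 L31–32 and LEMMA 27 (518)–(520) p.70 L69 – p.71 L26, §4.3 «the stability bound» (524)–(525)
p.71 L28–41, of the held arXiv text layer `paper:arxiv-2009.01156` (`p.NN Lnn` = PDF page ∕ text-layer line).  Writer
seat p11 (literature-prover-lit-balaban-p11-g25-0), YM LIT SWEEP item (c) D8 (row C08 «WHERE»: the row's Q2 token reads
«what IS proved: UV STABILITY OF QED₃ in a fixed finite volume, Thm 2 (stability bound) … proof §4.3 p.71 from Thm 1»;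
zero weight for the YM-INPRINT tokens).  Mathlib only.

**The printed text (verbatim, text layer).**  p.8 L65–76: *"As we will see in section 4, theorem 1 yields a proof of
the stability bound: Theorem 2. (stability bound) Let the coupling constant `e` be sufficiently small. Then for all `N`
`½ ≤ |Z(N,e)∕Z(N,0)| ≤ 3∕2` (42)"*.  p.68 L31–32: *"Lemma 25. For `e` sufficiently small `Z_L(N,e) ≤ Z(N,0)e_K` (498)"*.
p.70 L69 – p.71 L26: *"Lemma 27. Uniformly in `N` `Z_S(N,e)∕Z(N,0) = 1 + O(e_K^{1∕4−8ε})` (518)  Proof. The ratio is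
`Z_S(N,e)∕Z(N,0) = exp(ε⁰_K|T⁰_{N−K}|)·[∫(Ξ_K∕Z_f(N,0))χ_K Dm_K ∕ ∫χ_K Dm_K]·[∫χ_K Dm_K ∕ ∫Dm_K]` (519) It suffices to show
that each factor is sufficiently close to one. The first factor is say `1 + O(e_K⁶)` by (34) and `|T⁰_{N−K}| = (Mr_K)³`.
The second factor is `1 + O(e_K^{1∕4−8ε})` by lemma 26. For the third factor we define `ζ_K = 1 − χ_K` and write it as
`1 − ∫ζ_K Dm_K ∕ ∫Dm_K` (520) … Thus (520) is `1 + O(e_K)` and the result follows."*  p.71 L28–41: *"4.3 the stability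
bound  Now we can prove the main result  Proof of theorem 2: Combining lemma 25 and lemma 27 we have for `e` sufficiently
small and uniformly in `N` `Z(N,e)∕Z(N,0) = Z_L(N,e)∕Z(N,0) + Z_S(N,e)∕Z(N,0) = 1 + O(e_K^{1∕4−8ε})` (524) This gives the
stability bound of theorem 2 which we recall says `½ ≤ |Z(N,e)∕Z(N,0)| ≤ 3∕2` (525) It also shows that
`Z(N,e)∕Z(N,0) → 1` as `e → 0`."*

**What is formalized (kernel-checked, zero `sorry`, no named facts).**  The closing arithmetic, for elements of a normed
field (`ℂ`; the partition functions are complex once `e ≠ 0`):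
* §1 **(519) «each factor sufficiently close to one»** — `norm_mul_sub_one_le` (`‖ab − 1‖ ≤ ‖a − 1‖‖b‖ + ‖b − 1‖`),
  `norm_mul_sub_one_le_of_le` (`‖a − 1‖ ≤ δ₁`, `‖b − 1‖ ≤ δ₂ ≤ 1 ⟹ ‖ab − 1‖ ≤ 2δ₁ + δ₂`), **`eq519_three_factors`**
  (three factors within `δ₁, δ₂, δ₃` of `1`, `δ₁, δ₂ ≤ 1` ⟹ the product within `4(δ₁ + δ₂ + δ₃)` of `1`).
* §2 **(524)** — `eq524`: `Z∕Z₀ = Z_L∕Z₀ + Z_S∕Z₀` with `‖Z_L∕Z₀‖ ≤ a` (LEMMA 25, `a = e_K`) and `‖Z_S∕Z₀ − 1‖ ≤ b`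
  (LEMMA 27) ⟹ `‖Z∕Z₀ − 1‖ ≤ a + b`.
* §3 **(525) = THEOREM 2 (42)** — `stability_bound_of_norm_sub_one_le` (`‖r − 1‖ ≤ ½ ⟹ ½ ≤ ‖r‖ ≤ 3∕2`) and
  **`dimock_theorem2_of_lemmas25_27`**: from the two lemmas' bounds with `a + b ≤ ½` («for `e` sufficiently small»),
  `½ ≤ ‖Z(N,e)∕Z(N,0)‖ ≤ 3∕2`.
* §4 **«`Z(N,e)∕Z(N,0) → 1` as `e → 0`»** — `tendsto_one_of_norm_sub_one_le`: if `‖r(e) − 1‖ ≤ ε(e)` eventually and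
  `ε(e) → 0` along a filter, then `r(e) → 1`.
* §5 (v1.1, same seat) **LEMMA 27's printed proof, factor by factor** — `first_factor_519` (`|ε⁰_K| ≤ e_K⁷` (34),
  `|T⁰|e_K ≤ 1` ⟹ `|e^{ε⁰_K|T⁰|} − 1| ≤ 2e_K⁶`), `eq521` (the Chebyshev step `ζ_K ≤ exp(−p_K + (CM)²p_K⁻¹‖dA_K‖²)`),
  `sqrt_two_pow_le_exp`, `eq523_exponent`, `eq523` (`∫ζ_K ≤ e^{−p_K}∫e^{¼‖dA‖²} ≤ e^{−p_K}√2^T∫1 ≤ e_K∫1` once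
  `p_K ≥ T − log e_K`), `third_factor_520` ((520) within `e_K` of `1`), **`lemma27_assembled`** ((518):
  `‖Z_S∕Z₀ − 1‖ ≤ 4(2e_K⁶ + δ₂ + e_K)`, `δ₂` = LEMMA 26's bound), and `integral_exp_quarter_sq_norm` (the rescaling
  `A → √2A` PROVED for the pure Gaussian on a real inner-product space: `∫e^{¼‖v‖²}e^{−½‖v‖²} = √2^{dim V}∫e^{−½‖v‖²}`).

**Readings (declared).**  (i) `O(·)`-statements are carried as explicit bounds `≤ a`, `≤ b`; «for `e` sufficiently small»
= the hypothesis `a + b ≤ ½` (with (524)'s `a + b = O(e_K^{1∕4−8ε})` this is smallness of the running coupling `e_K`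
at the stop point `K`, i.e. of `e`).  (ii) LEMMA 25 is used as `‖Z_L∕Z₀‖ ≤ a` (the printed `Z_L ≤ Z(N,0)e_K` for the
positive quantities there).  (iii) Nothing here proves LEMMA 25, LEMMA 26 or (34) — they are the inputs; of LEMMA 27
exactly the printed steps (519)–(523) are proved (§5); its inputs LEMMA 26, (522)'s «(549)» and the measure-level
rescaling beyond the pure Gaussian are not.

**Honest scope.**  This is the half-page of §4.3 and the sentence structure of (519) as arithmetic; the substance of
THEOREM 2 is THEOREM 1 and LEMMAS 18–27 (not formalized here).  No `d = 4` statement; nothing about Bałaban's papers.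
-/

noncomputable section

namespace Literature.MathematicalPhysics.QuantumFieldTheory.Dimock2011to13

namespace QED3StabilityAssembly

open Filter Topology

variable {𝕜 : Type*} [NormedField 𝕜]

/-! ## §1 (519): «It suffices to show that each factor is sufficiently close to one» -/

/-- **two factors**: `‖ab − 1‖ ≤ ‖a − 1‖·‖b‖ + ‖b − 1‖` (`ab − 1 = (a − 1)b + (b − 1)`).
[cite: Dimock2022UVStabilityQED3, §4.2.3 Lemma 27 proof (519) p.70 L71 – p.71 L1] -/
theorem norm_mul_sub_one_le (a b : 𝕜) : ‖a * b - 1‖ ≤ ‖a - 1‖ * ‖b‖ + ‖b - 1‖ := by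
  have e : a * b - 1 = (a - 1) * b + (b - 1) := by ring
  rw [e]
  exact (norm_add_le _ _).trans (by rw [norm_mul])

/-- **two factors, quantified**: `‖a − 1‖ ≤ δ₁`, `‖b − 1‖ ≤ δ₂ ≤ 1` ⟹ `‖ab − 1‖ ≤ 2δ₁ + δ₂`.
[cite: Dimock2022UVStabilityQED3, §4.2.3 Lemma 27 proof (519) p.70 L71 – p.71 L1] -/
theorem norm_mul_sub_one_le_of_le {a b : 𝕜} {δ₁ δ₂ : ℝ} (ha : ‖a - 1‖ ≤ δ₁) (hb : ‖b - 1‖ ≤ δ₂) (hδ₂ : δ₂ ≤ 1) :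
    ‖a * b - 1‖ ≤ 2 * δ₁ + δ₂ := by
  have hδ₁ : 0 ≤ δ₁ := (norm_nonneg _).trans ha
  have hbn : ‖b‖ ≤ 1 + δ₂ := by
    have h1 : ‖b‖ ≤ ‖(1 : 𝕜)‖ + ‖b - 1‖ := by
      calc ‖b‖ = ‖1 + (b - 1)‖ := by rw [add_sub_cancel]
        _ ≤ ‖(1 : 𝕜)‖ + ‖b - 1‖ := norm_add_le _ _
    rw [norm_one] at h1
    linarith
  calc ‖a * b - 1‖ ≤ ‖a - 1‖ * ‖b‖ + ‖b - 1‖ := norm_mul_sub_one_le a b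
    _ ≤ δ₁ * (1 + δ₂) + δ₂ := add_le_add (mul_le_mul ha hbn (norm_nonneg _) hδ₁) hb
    _ ≤ 2 * δ₁ + δ₂ := by nlinarith

/-- **(519), three factors**: if `‖f_i − 1‖ ≤ δ_i` (`i = 1,2,3`; `δ₁, δ₂ ≤ 1`: «the first factor is say `1 + O(e_K⁶)` … the second
factor is `1 + O(e_K^{1∕4−8ε})` … (520) is `1 + O(e_K)`»), then `‖f₁f₂f₃ − 1‖ ≤ 4(δ₁ + δ₂ + δ₃)` — «and the result follows».
[cite: Dimock2022UVStabilityQED3, §4.2.3 Lemma 27 (518)–(520) p.70 L69 – p.71 L26] -/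
theorem eq519_three_factors {f₁ f₂ f₃ : 𝕜} {δ₁ δ₂ δ₃ : ℝ} (h₁ : ‖f₁ - 1‖ ≤ δ₁) (h₂ : ‖f₂ - 1‖ ≤ δ₂)
    (h₃ : ‖f₃ - 1‖ ≤ δ₃) (hδ₁ : δ₁ ≤ 1) (hδ₂ : δ₂ ≤ 1) :
    ‖f₁ * f₂ * f₃ - 1‖ ≤ 4 * (δ₁ + δ₂ + δ₃) := by
  have hδ₁0 : 0 ≤ δ₁ := (norm_nonneg _).trans h₁
  have hδ₂0 : 0 ≤ δ₂ := (norm_nonneg _).trans h₂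
  have hδ₃0 : 0 ≤ δ₃ := (norm_nonneg _).trans h₃
  have h12 : ‖f₁ * f₂ - 1‖ ≤ 2 * δ₁ + δ₂ := norm_mul_sub_one_le_of_le h₁ h₂ hδ₂
  have hf₃ : ‖f₃‖ ≤ 1 + δ₃ := by
    have h1 : ‖f₃‖ ≤ ‖(1 : 𝕜)‖ + ‖f₃ - 1‖ := by
      calc ‖f₃‖ = ‖1 + (f₃ - 1)‖ := by rw [add_sub_cancel]
        _ ≤ ‖(1 : 𝕜)‖ + ‖f₃ - 1‖ := norm_add_le _ _
    rw [norm_one] at h1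
    linarith
  calc ‖f₁ * f₂ * f₃ - 1‖ ≤ ‖f₁ * f₂ - 1‖ * ‖f₃‖ + ‖f₃ - 1‖ := norm_mul_sub_one_le (f₁ * f₂) f₃
    _ ≤ (2 * δ₁ + δ₂) * (1 + δ₃) + δ₃ :=
        add_le_add (mul_le_mul h12 hf₃ (norm_nonneg _) (by positivity)) h₃
    _ ≤ 4 * (δ₁ + δ₂ + δ₃) := by nlinarith

/-! ## §2 (524): «Combining lemma 25 and lemma 27» -/

/-- **(524)**: with `Z(N,e) = Z_L(N,e) + Z_S(N,e)` (the large- ∕ small-field split), LEMMA 25 in the form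
`‖Z_L∕Z₀‖ ≤ a` and LEMMA 27 in the form `‖Z_S∕Z₀ − 1‖ ≤ b`: `‖Z∕Z₀ − 1‖ ≤ a + b` — «`= 1 + O(e_K^{1∕4−8ε})`».
[cite: Dimock2022UVStabilityQED3, §4.3 proof of Thm 2 (524) p.71 L30–34; Lemma 25 (498) p.68 L31–32; Lemma 27 (518) p.70 L69–70] -/
theorem eq524 {Z ZL ZS Z₀ : 𝕜} (hsplit : Z = ZL + ZS) {a b : ℝ} (h25 : ‖ZL / Z₀‖ ≤ a) (h27 : ‖ZS / Z₀ - 1‖ ≤ b) :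
    ‖Z / Z₀ - 1‖ ≤ a + b := by
  have e : Z / Z₀ - 1 = ZL / Z₀ + (ZS / Z₀ - 1) := by rw [hsplit, add_div]; ring
  rw [e]
  exact (norm_add_le _ _).trans (add_le_add h25 h27)

/-! ## §3 (525) = THEOREM 2 (42): the stability bound -/

/-- **(525) from (524)**: `‖r − 1‖ ≤ ½ ⟹ ½ ≤ ‖r‖ ≤ 3∕2`. [cite: Dimock2022UVStabilityQED3, §4.3 (524)–(525) p.71 L30–40 and §2.2 Thm 2 (42) p.8 L66–76] -/
theorem stability_bound_of_norm_sub_one_le {r : 𝕜} (h : ‖r - 1‖ ≤ 1 / 2) : 1 / 2 ≤ ‖r‖ ∧ ‖r‖ ≤ 3 / 2 := by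
  have h1 : ‖r‖ ≤ ‖(1 : 𝕜)‖ + ‖r - 1‖ := by
    calc ‖r‖ = ‖1 + (r - 1)‖ := by rw [add_sub_cancel]
      _ ≤ ‖(1 : 𝕜)‖ + ‖r - 1‖ := norm_add_le _ _
  have h2 : ‖(1 : 𝕜)‖ ≤ ‖r‖ + ‖r - 1‖ := by
    calc ‖(1 : 𝕜)‖ = ‖r - (r - 1)‖ := by rw [sub_sub_cancel]
      _ ≤ ‖r‖ + ‖r - 1‖ := norm_sub_le _ _
  rw [norm_one] at h1 h2
  constructor <;> linarith

/-- **THEOREM 2 (42) ∕ (525), the stability bound, ASSEMBLED** — «Proof of theorem 2: Combining lemma 25 and lemma 27 we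
have for `e` sufficiently small and uniformly in `N` … (524) This gives the stability bound of theorem 2»: with
`Z(N,e) = Z_L + Z_S`, `‖Z_L∕Z(N,0)‖ ≤ a` (LEMMA 25), `‖Z_S∕Z(N,0) − 1‖ ≤ b` (LEMMA 27) and `a + b ≤ ½` («for `e` sufficiently
small»): `½ ≤ |Z(N,e)∕Z(N,0)| ≤ 3∕2`.
[cite: Dimock2022UVStabilityQED3, §2.2 Thm 2 (42) p.8 L65–76; §4.3 proof (524)–(525) p.71 L28–40] -/
theorem dimock_theorem2_of_lemmas25_27 {Z ZL ZS Z₀ : 𝕜} (hsplit : Z = ZL + ZS) {a b : ℝ}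
    (h25 : ‖ZL / Z₀‖ ≤ a) (h27 : ‖ZS / Z₀ - 1‖ ≤ b) (hsmall : a + b ≤ 1 / 2) :
    1 / 2 ≤ ‖Z / Z₀‖ ∧ ‖Z / Z₀‖ ≤ 3 / 2 :=
  stability_bound_of_norm_sub_one_le ((eq524 hsplit h25 h27).trans hsmall)

/-! ## §4 «It also shows that `Z(N,e)∕Z(N,0) → 1` as `e → 0`» -/

/-- **«`Z(N,e)∕Z(N,0) → 1` as `e → 0`»**: if along a filter `‖r(e) − 1‖ ≤ ε(e)` eventually and `ε(e) → 0` (the bound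
(524): `ε = O(e_K^{1∕4−8ε})`, `e_K → 0` with `e`), then `r(e) → 1`.
[cite: Dimock2022UVStabilityQED3, §4.3 p.71 L41 («It also shows that Z(N,e)/Z(N,0) → 1 as e → 0»)] -/
theorem tendsto_one_of_norm_sub_one_le {ι : Type*} {l : Filter ι} {r : ι → 𝕜} {ε : ι → ℝ}
    (hbound : ∀ᶠ i in l, ‖r i - 1‖ ≤ ε i) (hε : Tendsto ε l (𝓝 0)) : Tendsto r l (𝓝 1) := by
  rw [tendsto_iff_norm_sub_tendsto_zero]
  exact squeeze_zero_norm' (by simpa only [norm_norm] using hbound) hε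


/-! ## §5 (v1.1) LEMMA 27's own proof: the three factors of (519) one at a time — the first from (34), the third (520)
from (521)–(523), the second = LEMMA 26 — and LEMMA 27 (518) ASSEMBLED from them

p.70 L71 – p.71 L26 (verbatim, text layer): *"It suffices to show that each factor is sufficiently close to one. The
first factor is say `1 + O(e_K⁶)` by (34) and `|T⁰_{N−K}| = (Mr_K)³`. The second factor is `1 + O(e_K^{1∕4−8ε})` by
lemma 26. For the third factor we define `ζ_K = 1 − χ_K` and write it as `1 − ∫ζ_K Dm_K ∕ ∫Dm_K` (520) To analyze this
we follow lemma 24. The characteristic function `χ_K` imposes that `|dA_K| ≤ p_K`, and so `ζ_K` imposes that there is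
a bond in `Λ_K` such that `|dA_K| ≥ p_K`. However `|dA_K| ≤ CM‖dA_K‖_∞`, a special case of (476), so there must be a
bond where `|dA_K| ≥ (CM)⁻¹p_K`. Therefore `ζ_K ≤ exp(−p_K + (CM)²p_K⁻¹‖dA_K‖²)` (521) Furthermore `‖dA_K‖² ≤ O(1)‖dA_K‖²`,
a special case of (549), and so for `p_K` sufficiently large `∫ζ_K Dm_K ≤ e^{−p_K}∫e^{¼‖dA_k‖²}Dm_K` (522) In the last
integral we have `¼‖dA_k‖² − ½‖dA_k‖² = −¼‖dA_k‖²`. We restore the coefficient `−¼` to `−½` by the change of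
variables `A_K → √2A_K`. This introduces a factor of `√2` raised to a power bounded by `|Λ^{(K)}_K| = |T⁰_{N−K}| =
(Mr_K)³`. Thus for `p_K` sufficiently large `∫ζ_K Dm_K ≤ e^{−p_K+(Mr_K)³}∫Dm_K ≤ e_K∫Dm_K` (523) Thus (520) is
`1 + O(e_K)` and the result follows."*

Readings (declared): the first and third factors are real numbers (a real exponential; a ratio of integrals of
non-negative functions against the positive measure `Dm_K`), the second may be complex; «`√2` raised to a power
bounded by `|T⁰_{N−K}|`» is PROVED here for the pure Gaussian `e^{−½‖v‖²}dv` on a real inner-product space of that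
dimension (`integral_exp_quarter_sq_norm`) and otherwise carried as the hypothesis `I_¼ ≤ √2^T·I`; (522)'s input
«`‖dA_K‖² ≤ O(1)‖dA_K‖²` (549)» is not reproduced (it enters only through the hypothesis `h522`). -/

section LemmaTwentySeven

/-- **first factor of (519)** — «The first factor is say `1 + O(e_K⁶)` by (34) and `|T⁰_{N−K}| = (Mr_K)³`»: with
`|ε⁰_K| ≤ e_K⁷` ((34)), `T = |T⁰_{N−K}| ≥ 0`, `0 ≤ e_K ≤ 1` and the smallness `T·e_K ≤ 1` (i.e. `(Mr_K)³e_K ≤ 1`, true for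
`e_K` small since `r_K ≤ L(−log e_K)^r` by LEMMA 17): `|exp(ε⁰_K·T) − 1| ≤ 2e_K⁶`.
[cite: Dimock2022UVStabilityQED3, §4.2.3 Lemma 27 proof p.70 L71–72; §2.2 (34) p.6 L65–66] -/
theorem first_factor_519 {ε T e : ℝ} (h34 : |ε| ≤ e ^ 7) (hT : 0 ≤ T) (he : 0 ≤ e) (he1 : e ≤ 1)
    (hsmall : T * e ≤ 1) : |Real.exp (ε * T) - 1| ≤ 2 * e ^ 6 := by
  have h6 : 0 ≤ e ^ 6 := pow_nonneg he 6
  have hx : |ε * T| ≤ e ^ 6 := by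
    rw [abs_mul, abs_of_nonneg hT]
    calc |ε| * T ≤ e ^ 7 * T := mul_le_mul_of_nonneg_right h34 hT
      _ = e ^ 6 * (T * e) := by ring
      _ ≤ e ^ 6 * 1 := mul_le_mul_of_nonneg_left hsmall h6
      _ = e ^ 6 := mul_one _
  have hx1 : |ε * T| ≤ 1 := hx.trans (pow_le_one₀ he he1)
  calc |Real.exp (ε * T) - 1| ≤ 2 * |ε * T| := Real.abs_exp_sub_one_le hx1
    _ ≤ 2 * e ^ 6 := by linarith

/-- **(521)** (the Chebyshev step, «we follow lemma 24»): if `ζ ≤ 1` and `ζ > 0` forces a bond `b` with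
`|dA(b)| ≥ p∕c` (`c = CM`), then `ζ ≤ exp(−p + c²p⁻¹‖dA‖²)`, `‖dA‖² = Σ_b |dA(b)|²` — because at such a bond
`c²p⁻¹|dA(b)|² ≥ p`. [cite: Dimock2022UVStabilityQED3, §4.2.3 Lemma 27 proof (521) p.70 L76–80] -/
theorem eq521 {B : Type*} (s : Finset B) (dA : B → ℝ) {ζ p c : ℝ} (hζ : ζ ≤ 1) (hp : 0 < p) (hc : 0 < c)
    (hbond : 0 < ζ → ∃ b ∈ s, p / c ≤ |dA b|) :
    ζ ≤ Real.exp (-p + c ^ 2 * p⁻¹ * ∑ b ∈ s, dA b ^ 2) := by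
  by_cases hz : 0 < ζ
  · obtain ⟨b, hb, hle⟩ := hbond hz
    have h1 : (p / c) ^ 2 ≤ dA b ^ 2 := by
      rw [← sq_abs (dA b)]
      exact pow_le_pow_left₀ (div_nonneg hp.le hc.le) hle 2
    have h2 : dA b ^ 2 ≤ ∑ b' ∈ s, dA b' ^ 2 :=
      Finset.single_le_sum (f := fun b' => dA b' ^ 2) (fun _ _ => sq_nonneg _) hb
    have h3 : p ≤ c ^ 2 * p⁻¹ * ∑ b' ∈ s, dA b' ^ 2 := by
      have hcp : c ^ 2 * p⁻¹ * (p / c) ^ 2 = p := by field_simp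
      calc p = c ^ 2 * p⁻¹ * (p / c) ^ 2 := hcp.symm
        _ ≤ c ^ 2 * p⁻¹ * ∑ b' ∈ s, dA b' ^ 2 :=
            mul_le_mul_of_nonneg_left (h1.trans h2) (by positivity)
    calc ζ ≤ 1 := hζ
      _ ≤ Real.exp (-p + c ^ 2 * p⁻¹ * ∑ b' ∈ s, dA b' ^ 2) := Real.one_le_exp (by linarith)
  · exact (not_lt.mp hz).trans (Real.exp_pos _).le

/-- `√2 ≤ e`, hence `√2^T ≤ e^T` — the printed replacement of «a factor of `√2` raised to a power bounded by `(Mr_K)³`»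
by `e^{(Mr_K)³}` in (523). [cite: Dimock2022UVStabilityQED3, §4.2.3 Lemma 27 proof (523) p.71 L18–24] -/
theorem sqrt_two_pow_le_exp (T : ℕ) : Real.sqrt 2 ^ T ≤ Real.exp T := by
  have h1 : Real.sqrt 2 ≤ 2 := by
    have h := Real.sqrt_le_sqrt (show (2 : ℝ) ≤ 2 ^ 2 by norm_num)
    rwa [Real.sqrt_sq (by norm_num : (0 : ℝ) ≤ 2)] at h
  have h2 : (2 : ℝ) ≤ Real.exp 1 := by
    have := Real.add_one_le_exp (1 : ℝ)
    linarith
  calc Real.sqrt 2 ^ T ≤ Real.exp 1 ^ T := pow_le_pow_left₀ (Real.sqrt_nonneg _) (h1.trans h2) T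
    _ = Real.exp T := by rw [← Real.exp_nat_mul, mul_one]

/-- **(523), the exponent**: `e^{−p_K + T} ≤ e_K` as soon as `p_K ≥ T − log e_K` («for `p_K` sufficiently large»;
`T = (Mr_K)³`). [cite: Dimock2022UVStabilityQED3, §4.2.3 Lemma 27 proof (523) p.71 L22–24] -/
theorem eq523_exponent {p T eK : ℝ} (heK : 0 < eK) (hp : T - Real.log eK ≤ p) :
    Real.exp (-p + T) ≤ eK := by
  calc Real.exp (-p + T) ≤ Real.exp (Real.log eK) := Real.exp_le_exp.mpr (by linarith)
    _ = eK := Real.exp_log heK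

/-- **(522) ⟹ (523)** as numbers: with `I_ζ = ∫ζ_K Dm_K`, `I_¼ = ∫e^{¼‖dA‖²}Dm_K`, `I = ∫Dm_K ≥ 0`: from (522)
`I_ζ ≤ e^{−p_K}I_¼`, the rescaling `I_¼ ≤ √2^T·I` and `p_K ≥ T − log e_K`: `I_ζ ≤ e_K·I`.
[cite: Dimock2022UVStabilityQED3, §4.2.3 Lemma 27 proof (522)–(523) p.71 L14–24] -/
theorem eq523 {Iζ Iq I p eK : ℝ} {T : ℕ} (hI : 0 ≤ I) (heK : 0 < eK)
    (h522 : Iζ ≤ Real.exp (-p) * Iq) (hscale : Iq ≤ Real.sqrt 2 ^ T * I)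
    (hp : (T : ℝ) - Real.log eK ≤ p) : Iζ ≤ eK * I := by
  have hexp : 0 ≤ Real.exp (-p) := (Real.exp_pos _).le
  calc Iζ ≤ Real.exp (-p) * Iq := h522
    _ ≤ Real.exp (-p) * (Real.sqrt 2 ^ T * I) := mul_le_mul_of_nonneg_left hscale hexp
    _ ≤ Real.exp (-p) * (Real.exp T * I) :=
        mul_le_mul_of_nonneg_left (mul_le_mul_of_nonneg_right (sqrt_two_pow_le_exp T) hI) hexp
    _ = Real.exp (-p + T) * I := by rw [Real.exp_add]; ring
    _ ≤ eK * I := mul_le_mul_of_nonneg_right (eq523_exponent heK hp) hI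

/-- **third factor (520)**: `∫χ_K Dm_K ∕ ∫Dm_K = 1 − ∫ζ_K Dm_K ∕ ∫Dm_K` (`χ_K = 1 − ζ_K`, so `I_χ = I − I_ζ`), and with
`0 ≤ I_ζ ≤ e_K·I`, `I > 0` ((523)): the third factor is within `e_K` of `1` — «Thus (520) is `1 + O(e_K)`».
[cite: Dimock2022UVStabilityQED3, §4.2.3 Lemma 27 proof (520), (523) p.70 L73–75, p.71 L22–26] -/
theorem third_factor_520 {Iζ I eK : ℝ} (hI : 0 < I) (hζ0 : 0 ≤ Iζ) (h523 : Iζ ≤ eK * I) :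
    (I - Iζ) / I = 1 - Iζ / I ∧ |(I - Iζ) / I - 1| ≤ eK := by
  have hid : (I - Iζ) / I = 1 - Iζ / I := by rw [sub_div, div_self hI.ne']
  refine ⟨hid, ?_⟩
  rw [hid, show (1 - Iζ / I) - 1 = -(Iζ / I) by ring, abs_neg, abs_of_nonneg (div_nonneg hζ0 hI.le),
    div_le_iff₀ hI]
  exact h523

/-- **LEMMA 27 (518) ASSEMBLED from its printed proof**: the ratio (519) `Z_S(N,e)∕Z(N,0) = f₁·f₂·f₃` with
`f₁ = exp(ε⁰_K|T⁰_{N−K}|)` (`|ε⁰_K| ≤ e_K⁷` by (34), `|T⁰_{N−K}|·e_K ≤ 1`), `‖f₂ − 1‖ ≤ δ₂ ≤ 1` (LEMMA 26: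
`δ₂ = O(e_K^{1∕4−8ε})`), `f₃ = (I − I_ζ)∕I` with `0 ≤ I_ζ ≤ e_K·I` ((520)–(523)), and `0 ≤ e_K ≤ ½`:
`‖Z_S(N,e)∕Z(N,0) − 1‖ ≤ 4(2e_K⁶ + δ₂ + e_K)` — «`= 1 + O(e_K^{1∕4−8ε})`» (the middle term dominates).  The real factors
are embedded by `algebraMap ℝ 𝕜` (`𝕜 = ℝ` or `ℂ`).
[cite: Dimock2022UVStabilityQED3, §4.2.3 Lemma 27 (518)–(523) p.70 L69 – p.71 L26; Lemma 26 (499) p.69 L1–3] -/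
theorem lemma27_assembled {𝕂 : Type*} [NormedField 𝕂] [NormedAlgebra ℝ 𝕂] {ε T e δ₂ Iζ I : ℝ} {f₂ : 𝕂}
    (h34 : |ε| ≤ e ^ 7) (hT : 0 ≤ T) (he : 0 ≤ e) (he1 : e ≤ 1 / 2) (hsmall : T * e ≤ 1)
    (h26 : ‖f₂ - 1‖ ≤ δ₂) (hδ₂ : δ₂ ≤ 1) (hI : 0 < I) (hζ0 : 0 ≤ Iζ) (h523 : Iζ ≤ e * I) :
    ‖algebraMap ℝ 𝕂 (Real.exp (ε * T)) * f₂ * algebraMap ℝ 𝕂 ((I - Iζ) / I) - 1‖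
      ≤ 4 * (2 * e ^ 6 + δ₂ + e) := by
  have hemb : ∀ x : ℝ, ‖algebraMap ℝ 𝕂 x - 1‖ = |x - 1| := by
    intro x
    rw [← (algebraMap ℝ 𝕂).map_one, ← map_sub, norm_algebraMap', Real.norm_eq_abs]
  have h₁ : ‖algebraMap ℝ 𝕂 (Real.exp (ε * T)) - 1‖ ≤ 2 * e ^ 6 := by
    rw [hemb]; exact first_factor_519 h34 hT he (by linarith) hsmall
  have h₃ : ‖algebraMap ℝ 𝕂 ((I - Iζ) / I) - 1‖ ≤ e := by
    rw [hemb]; exact (third_factor_520 hI hζ0 h523).2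
  have hδ₁ : 2 * e ^ 6 ≤ 1 := by
    have : e ^ 6 ≤ (1 / 2) ^ 6 := pow_le_pow_left₀ he he1 6
    nlinarith
  exact eq519_three_factors h₁ h26 h₃ hδ₁ hδ₂

end LemmaTwentySeven

section Gaussian

variable {V : Type*} [NormedAddCommGroup V] [InnerProductSpace ℝ V] [FiniteDimensional ℝ V]
  [MeasurableSpace V] [BorelSpace V]

/-- **(522) → (523), the rescaling, PROVED for the pure Gaussian**: «In the last integral we have
`¼‖dA‖² − ½‖dA‖² = −¼‖dA‖²`. We restore the coefficient `−¼` to `−½` by the change of variables `A_K → √2A_K`. This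
introduces a factor of `√2` raised to a power bounded by `|T⁰_{N−K}|`» — on a real inner-product space `V` of dimension
`n`: `∫_V e^{¼‖v‖²}e^{−½‖v‖²}dv = (√2)ⁿ·∫_V e^{−½‖v‖²}dv` (Mathlib's Gaussian integral
`∫e^{−b‖v‖²} = (π∕b)^{n∕2}`). [cite: Dimock2022UVStabilityQED3, §4.2.3 Lemma 27 proof (522)–(523) p.71 L14–22] -/
theorem integral_exp_quarter_sq_norm :
    ∫ v : V, Real.exp (1 / 4 * ‖v‖ ^ 2) * Real.exp (-(1 / 2) * ‖v‖ ^ 2)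
      = Real.sqrt 2 ^ Module.finrank ℝ V * ∫ v : V, Real.exp (-(1 / 2) * ‖v‖ ^ 2) := by
  have h1 : ∀ v : V, Real.exp (1 / 4 * ‖v‖ ^ 2) * Real.exp (-(1 / 2) * ‖v‖ ^ 2)
      = Real.exp (-(1 / 4) * ‖v‖ ^ 2) := by
    intro v; rw [← Real.exp_add]; ring_nf
  simp_rw [h1]
  rw [GaussianFourier.integral_rexp_neg_mul_sq_norm (by norm_num : (0 : ℝ) < 1 / 4),
    GaussianFourier.integral_rexp_neg_mul_sq_norm (by norm_num : (0 : ℝ) < 1 / 2)]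
  have hπ : Real.pi / (1 / 4) = 2 * (Real.pi / (1 / 2)) := by ring
  rw [hπ, Real.mul_rpow (by norm_num) (by positivity)]
  congr 1
  rw [Real.sqrt_eq_rpow, ← Real.rpow_natCast, ← Real.rpow_mul (by norm_num)]
  congr 1
  ring

end Gaussian

end QED3StabilityAssembly

end Literature.MathematicalPhysics.QuantumFieldTheory.Dimock2011to13
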